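import Mathlib
import Summits.KontsevichZagierPeriods.KontsevichZagierPeriods.Statement
import Summits.KontsevichZagierPeriods.KontsevichZagierPeriods.Theorems.TorsionLogsNeronTorsionSectorAssemblyMain
import Summits.KontsevichZagierPeriods.KontsevichZagierPeriods.Theorems.TorsionLogsNeronTorsionSector

/-!
# On-path lemma for the rung `NeronTorsionHeightChain` (F4) — conditional form

`KontsevichZagierPeriods → NeronTorsionHeightChain`: the summit is NOT needed at all — the rung is the
PROVED floor (`Cruxes.NeronTorsionSector.Translation.stub_assembly`) plus ONE classical value identity,
the archimedean Néron local height of a real torsion point read in the tree's integral language: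

  `NeronTorsionValueIdentity`:
  `(N−2)·(4N²·rI.value + (N−2a)²·rP.value) = 4N·log|ψ_{N−1}(x_P, y_P/2)| − N²(N−2)·log(3e₁² − g₂/4)`.

Derivation (for the lander; every ingredient is in the tree): with `Λ` the real lattice of invariants
`g₂, g₃`, `ω₁ = 2∫_{e₁}^∞ dx/√f`, `η = 2ζ(ω₁/2)`, `u_P = ∫_{x_P}^∞ dx/√f = (a/N)·ω₁`:
`rI.value = log|σ(ω₁/2)| − log|σ(u_P)| − (η/2)(ω₁/2 − u_P)` and `rP.value = η·ω₁/2`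
(`TorsionLogs.NeronDuplication.iterated_integral_weierstrassPRe`, `…FlexRepValues`, `…FlexQuasiPeriod`);
`λ̃(u) := −log|σ(u)| + η u²/(2ω₁)` is even and `ω₁`-periodic (`σ(u+ω₁) = −e^{η(u+ω₁/2)}σ(u)`);
`σ(nu) = (−1)^{n+1} ψₙ(℘u, ℘'u/2) σ(u)^{n²}` (`PeriodPair.weierstrassSigma_nat_mul`,
`Literature/NumberTheory/EllipticCurves/WeierstrassSigmaDivision.lean`) at `n = N−1`
(`(N−1)u_P ≡ −u_P mod ω₁`) gives `λ̃(u_P) = log|ψ_{N−1}(P)|/(N²−2N)`, and at `n = 3`, `u = ω₁/2`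
(`ψ₃(e₁) = −(3e₁²−g₂/4)²`) gives `λ̃(ω₁/2) = ¼·log(3e₁²−g₂/4)`; finally
`rI.value + ρ²·rP.value = λ̃(u_P) − λ̃(ω₁/2)`, `ρ = ½ − a/N`.  The case `N − 1 = 2` of this identity
(with `2P` in place of the torsion reflection) is LANDED: `TorsionLogs.NeronDuplication.neronDuplication_value_identity`.
[Silverman 1994, Thm VI.1.1, VI.3.2, Ex. 6.3; Lang 1978, Ch. I–II]

Proved here (no `sorry`): `neronTorsionHeightChain_of_value : NeronTorsionValueIdentity → NeronTorsionHeightChain`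
(floor + KZ soundness `relations_le_ker_eval_holds` + `logRep_value` + the tie `q(N−2a) = 2Np`), and the
on-path form `onpath : KontsevichZagierPeriods → NeronTorsionValueIdentity → NeronTorsionHeightChain`.
-/

-- single-conjunct summit: Sub = Summit, so the namespace segment repeats by design (CONVENTIONS §2)
set_option linter.dupNamespace false

namespace Summit.KontsevichZagierPeriods.KontsevichZagierPeriods.Cruxes.NeronTorsionFlex.NeronHeight.OnPath

open Literature.NumberTheory.Transcendental
open Summit.KontsevichZagierPeriods.KontsevichZagierPeriods.Cruxes.NeronTorsionSector.Translation
  (stub_assembly logRep_value)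

/-- The rung, verbatim `Lines/NeronHeight.lean :: NeronTorsionHeightChain`. -/
def NeronTorsionHeightChain : Prop :=
  ∀ (g₂ g₃ e₁ xP yP : ℝ) (N a p q : ℕ) (f : ℝ → ℝ), (∀ x, f x = 4 * x ^ 3 - g₂ * x - g₃) →
    g₂ ^ 3 - 27 * g₃ ^ 2 ≠ 0 → f e₁ = 0 → 0 < e₁ → (∀ x, e₁ < x → 0 < f x) → e₁ < xP →
    yP ^ 2 = f xP → 3 ≤ N → 0 < a → 2 * a < N →
    (∀ hns : (⟨0, 0, 0, -g₂ / 4, -g₃ / 4⟩ : WeierstrassCurve ℝ).toAffine.Nonsingular xP (yP / 2),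
      addOrderOf (WeierstrassCurve.Affine.Point.some xP (yP / 2) hns) = N) →
    (N : ℝ) * (∫ x in Set.Ioi xP, (Real.sqrt (f x))⁻¹) =
      a * (2 * ∫ x in Set.Ioi e₁, (Real.sqrt (f x))⁻¹) →
    Nat.Coprime p q → (q : ℤ) * ((N : ℤ) - 2 * (a : ℤ)) = (p : ℤ) * (2 * (N : ℤ)) →
    ∀ (rI rP : KZ.IntegralRep 2),
      rI.domain = {z | e₁ < z 1 ∧ z 1 < z 0 ∧ z 0 < xP} →
      Set.EqOn rI.integrand (fun z => z 1 / (Real.sqrt (f (z 1)) * Real.sqrt (f (z 0)))) rI.domain →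
      rP.domain = {z | e₁ < z 0 ∧ e₁ < z 1} →
      Set.EqOn rP.integrand
        (fun z => (Real.sqrt (f (z 0)))⁻¹ * ((g₂ * z 1 + 2 * g₃) / (2 * (z 1) ^ 2 * Real.sqrt (f (z 1)))))
        rP.domain →
      ∃ (c : ℤ) (B : ℝ) (rB : KZ.IntegralRep 1), 1 < B ∧ IsAlgebraic ℚ B ∧
        rB.domain = {t | 1 < t 0 ∧ t 0 < B} ∧ Set.EqOn rB.integrand (fun t => (t 0)⁻¹) rB.domain ∧
        ((q : ℤ) ^ 2) • KZ.of rI + ((p : ℤ) ^ 2) • KZ.of rP - c • KZ.of rB ∈ KZ.relations ∧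
        4 * (N : ℝ) * ((N : ℝ) - 2) * ((c : ℝ) * Real.log B) =
          (q : ℝ) ^ 2 * (4 * Real.log
              |((⟨0, 0, 0, -g₂ / 4, -g₃ / 4⟩ : WeierstrassCurve ℝ).ψ ((N : ℤ) - 1)).evalEval xP (yP / 2)|
            - (N : ℝ) * ((N : ℝ) - 2) * Real.log (3 * e₁ ^ 2 - g₂ / 4))

/-- **The Néron–torsion value identity** (classical; the lander's target): the archimedean local height
of the real `N`-torsion point `P` in the tree's integral language. [Silverman 1994, VI.1.1, VI.3.2] -/
def NeronTorsionValueIdentity : Prop :=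
  ∀ (g₂ g₃ e₁ xP yP : ℝ) (N a : ℕ) (f : ℝ → ℝ), (∀ x, f x = 4 * x ^ 3 - g₂ * x - g₃) →
    g₂ ^ 3 - 27 * g₃ ^ 2 ≠ 0 → f e₁ = 0 → 0 < e₁ → (∀ x, e₁ < x → 0 < f x) → e₁ < xP →
    yP ^ 2 = f xP → 3 ≤ N → 0 < a → 2 * a < N →
    (∀ hns : (⟨0, 0, 0, -g₂ / 4, -g₃ / 4⟩ : WeierstrassCurve ℝ).toAffine.Nonsingular xP (yP / 2),
      addOrderOf (WeierstrassCurve.Affine.Point.some xP (yP / 2) hns) = N) →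
    (N : ℝ) * (∫ x in Set.Ioi xP, (Real.sqrt (f x))⁻¹) =
      a * (2 * ∫ x in Set.Ioi e₁, (Real.sqrt (f x))⁻¹) →
    ∀ (rI rP : KZ.IntegralRep 2),
      rI.domain = {z | e₁ < z 1 ∧ z 1 < z 0 ∧ z 0 < xP} →
      Set.EqOn rI.integrand (fun z => z 1 / (Real.sqrt (f (z 1)) * Real.sqrt (f (z 0)))) rI.domain →
      rP.domain = {z | e₁ < z 0 ∧ e₁ < z 1} →
      Set.EqOn rP.integrand
        (fun z => (Real.sqrt (f (z 0)))⁻¹ * ((g₂ * z 1 + 2 * g₃) / (2 * (z 1) ^ 2 * Real.sqrt (f (z 1)))))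
        rP.domain →
      ((N : ℝ) - 2) * (4 * (N : ℝ) ^ 2 * rI.value + ((N : ℝ) - 2 * a) ^ 2 * rP.value) =
        4 * (N : ℝ) * Real.log
            |((⟨0, 0, 0, -g₂ / 4, -g₃ / 4⟩ : WeierstrassCurve ℝ).ψ ((N : ℤ) - 1)).evalEval xP (yP / 2)|
          - (N : ℝ) ^ 2 * ((N : ℝ) - 2) * Real.log (3 * e₁ ^ 2 - g₂ / 4)

/-- **Floor + value identity ⟹ rung** (no `sorry`): the chain of `stub_assembly` is KZ-sound
(`relations_le_ker_eval_holds`: `q²·rI.value + p²·rP.value = c·log B`), and the tie `q(N−2a) = 2Np`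
turns the value identity into the pin. -/
theorem neronTorsionHeightChain_of_value (hV : NeronTorsionValueIdentity) : NeronTorsionHeightChain := by
  intro g₂ g₃ e₁ xP yP N a p q f hf hΔ hfe he₁ hpos hxP hyP hN ha haN htor hper hpq htie rI rP hIdom hIint
    hPdom hPint
  obtain ⟨c, B, rB, hB1, hBalg, hBdom, hBint, hchain⟩ :=
    stub_assembly g₂ g₃ e₁ xP yP N a p q f hf hΔ hfe he₁ hpos hxP hyP hN ha haN htor hper hpq htie rI rP
      hIdom hIint hPdom hPint
  refine ⟨c, B, rB, hB1, hBalg, hBdom, hBint, hchain, ?_⟩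
  -- KZ soundness: the chain evaluates to zero
  have hsound : (q : ℝ) ^ 2 * rI.value + (p : ℝ) ^ 2 * rP.value - c * Real.log B = 0 := by
    have h := KZ.relations_le_ker_eval_holds hchain
    rw [AddMonoidHom.mem_ker] at h
    simpa [map_add, map_sub, map_zsmul, KZ.eval_of, zsmul_eq_mul, logRep_value hB1.le rB hBdom hBint]
      using h
  have hVi := hV g₂ g₃ e₁ xP yP N a f hf hΔ hfe he₁ hpos hxP hyP hN ha haN htor hper rI rP hIdom hIint
    hPdom hPint
  have htie' : (q : ℝ) * ((N : ℝ) - 2 * a) = p * (2 * N) := by exact_mod_cast htie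
  have hN0 : (N : ℝ) ≠ 0 := by
    have : (3 : ℝ) ≤ N := by exact_mod_cast hN
    linarith
  apply mul_left_cancel₀ hN0
  set L := Real.log |((⟨0, 0, 0, -g₂ / 4, -g₃ / 4⟩ : WeierstrassCurve ℝ).ψ ((N : ℤ) - 1)).evalEval xP
    (yP / 2)| with hL
  set LD := Real.log (3 * e₁ ^ 2 - g₂ / 4) with hLD
  linear_combination (-(4 * (N : ℝ) ^ 2 * ((N : ℝ) - 2))) * hsound + ((q : ℝ) ^ 2) * hVi
    - (((N : ℝ) - 2) * rP.value * ((q : ℝ) * ((N : ℝ) - 2 * a) + p * (2 * N))) * htie'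

/-- **On-path form (F4).** `KontsevichZagierPeriods → (value identity) → rung`; the summit hypothesis is
not even used — the rung is the proved floor plus the classical identity. -/
theorem onpath (_hS : KontsevichZagierPeriods) (hV : NeronTorsionValueIdentity) : NeronTorsionHeightChain :=
  neronTorsionHeightChain_of_value hV

end Summit.KontsevichZagierPeriods.KontsevichZagierPeriods.Cruxes.NeronTorsionFlex.NeronHeight.OnPath
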